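import Literature.AlgebraicGeometry.Resolution.SupportFirstPreDatum
import Literature.AlgebraicGeometry.Resolution.AlterationsNormalForm
import Literature.AlgebraicGeometry.Resolution.AdicQuotient
import Literature.AlgebraicGeometry.Resolution.AdicCompletionRegular
import Literature.AlgebraicGeometry.Resolution.AlterationsSingularComponents
import Literature.AlgebraicGeometry.Resolution.PointBlowupHsFunMono
import Literature.AlgebraicGeometry.Resolution.StalkIdealLemmas
import Summits.ResolutionOfSingularities.ResolutionOfSingularities.Theorems.WeightedInvariantWeightedConstructionExtReesBridge
import Summits.ResolutionOfSingularities.ResolutionOfSingularities.Theorems.WeightedInvariantWeightedConstructionCobordantBlowupRegular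
import Mathlib.AlgebraicGeometry.IdealSheaf.Subscheme
import Mathlib.RingTheory.AdicCompletion.LocalRing

/-!
# `WeightedInvariant.WeightedConstruction`, line `support-first-weights-second`:
# singularity of the strict transform read in formal coordinates

Route `ResolutionOfSingularities/WeightedInvariant`, crux `WeightedConstruction`
(stmt-ResolutionOfSingularities-0571), stub `stub_formalSingularPt` of the lead skeleton (the
formal-chart package, cycle 2).

Let `R` be a regular weighted centre on the smooth separated quasi-compact `Y → Spec k`,
`U ⊆ Y` an affine open, `I = R.chartIdeals U`, `B = B(U) = Spec Γ(U)[t⁻¹, Rₙ(U) tⁿ]` the full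
cobordant blow-up, `ι : B₊(U) → B` the open immersion of the complement of the vertex, `X` an
ideal sheaf on `Y` and `X' = R.cobordantStrictTransform U X = (idealSheaf I σˢ(X(U))).comap ι`
its strict transform on `B₊(U)`. For a point `b` of `B₊(U)` in the support of `X'`, `b̄ = ι b`,
any Noetherian ring `S` and any ring isomorphism `eB : 𝒪̂_{B,b̄} ≃ S`:

  `X'` is singular at `b` iff `S ⧸ eB(σˢ(X(U)) · 𝒪̂_{B,b̄})` is not a regular local ring.

Proof (all folklore, assembled from the tree):
* the unique point of `X'.subscheme` over `b` is `⟨b, hb⟩`, and its local ring is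
  `𝒪_{B₊,b} ⧸ X'_b` (`isRegularLocalRing_stalk_subscheme_iff`: the closed immersion
  `X'.subscheme → B₊` has surjective stalk maps with kernel the stalk ideal);
* along the open immersion `ι`, `𝒪_{B,b̄} ≅ 𝒪_{B₊,b}` carries the stalk ideal of
  `idealSheaf I σˢ` to that of its pull-back `X'` (`stalkIdeal_comap_eq_map_stalkMap`);
* `𝒪_{B,b̄}` is Noetherian (`B` is regular: landed `stub_cobordantBlowup_regular` with the
  landed bridge `stub_extRees_bridge`), and for a Noetherian local ring `T` and an ideal `J`,
  `T ⧸ J` is regular iff `T̂ ⧸ J T̂ ≅ (T ⧸ J)^` is (Matsumura Thm. 8.11, `quotientCompletionEquiv`;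
  a Noetherian local ring is regular iff its completion is, `isRegularLocalRing_adicCompletion`
  / `isRegularLocalRing_of_adicCompletion_equiv`) —
  `FormalSingularPt.isRegularLocalRing_quotient_iff_adicCompletion`;
* transport along `eB` (`Ideal.quotientEquiv`), the completed stalk ideal being `J T̂`
  (`completedStalkIdeal`, `stalkIdeal_eq_map_germ`).

Contents:
* `FormalSingularPt.isRegularLocalRing_quotient_iff_adicCompletion` — the completion step;
* `FormalSingularPt.isSingularPt_comap_iff_of_isOpenImmersion` — the statement for any open
  immersion `ι : P → B`, ideal sheaf `K` on `B` and point of `(K.comap ι).support` with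
  Noetherian `𝒪_{B,ι b}`;
* `stub_formalSingularPt` — the registered stub.
-/

noncomputable section

set_option linter.dupNamespace false -- mandated namespace of this single-conjunct summit

open CategoryTheory CategoryTheory.Limits AlgebraicGeometry TopologicalSpace
open Literature.AlgebraicGeometry.Resolution
open scoped LaurentPolynomial

namespace Summit.ResolutionOfSingularities.ResolutionOfSingularities.Theorems

namespace FormalSingularPt

universe u

open IsLocalRing

/-- **A quotient of a Noetherian local ring is regular iff the corresponding quotient of the
completion is**: for a Noetherian local ring `T` and an ideal `J`, `T ⧸ J` is a regular local ring
iff `T̂ ⧸ J T̂` is, where `T̂` is the `𝔪_T`-adic completion — `T̂ ⧸ J T̂ ≅ (T ⧸ J)^`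
(completion commutes with quotients, Matsumura Thm. 8.11) and a Noetherian local ring is regular
iff its completion is (both sides force `J ≠ ⊤`). [folklore] -/
theorem isRegularLocalRing_quotient_iff_adicCompletion {T : Type u} [CommRing T] [IsLocalRing T]
    [IsNoetherianRing T] (J : Ideal T) :
    IsRegularLocalRing (T ⧸ J) ↔
      IsRegularLocalRing (AdicCompletion (maximalIdeal T) T ⧸
        J.map (algebraMap T (AdicCompletion (maximalIdeal T) T))) := by
  have key : J ≠ ⊤ → (IsRegularLocalRing (T ⧸ J) ↔
      IsRegularLocalRing (AdicCompletion (maximalIdeal T) T ⧸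
        J.map (algebraMap T (AdicCompletion (maximalIdeal T) T)))) := by
    intro hJ
    haveI : Nontrivial (T ⧸ J) := Ideal.Quotient.nontrivial_iff.mpr hJ
    haveI : IsLocalRing (T ⧸ J) :=
      IsLocalRing.of_surjective' (Ideal.Quotient.mk J) Ideal.Quotient.mk_surjective
    have hmax : (maximalIdeal T).map (Ideal.Quotient.mk J) = maximalIdeal (T ⧸ J) :=
      IsLocalRing.map_maximalIdeal_of_surjective (Ideal.Quotient.mk J) Ideal.Quotient.mk_surjective
    let e := quotientCompletionEquiv (maximalIdeal T) J
    constructor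
    · intro h
      have h1 : IsRegularLocalRing (AdicCompletion (maximalIdeal (T ⧸ J)) (T ⧸ J)) :=
        isRegularLocalRing_adicCompletion (T ⧸ J)
      rw [← hmax] at h1
      exact IsRegularLocalRing.of_ringEquiv e.symm
    · intro h
      haveI := h
      exact isRegularLocalRing_of_adicCompletion_equiv hmax e.symm
  constructor
  · intro h
    exact (key (Ideal.Quotient.nontrivial_iff.mp inferInstance)).mp h
  · intro h
    have hJ : J ≠ ⊤ := by
      rintro rfl
      rw [Ideal.map_top] at h
      exact Ideal.Quotient.nontrivial_iff.mp
        (inferInstance : Nontrivial (AdicCompletion (maximalIdeal T) T ⧸ (⊤ : Ideal _))) rfl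
    exact (key hJ).mpr h

/-- **Singularity of a pulled-back closed subscheme along an open immersion, read in the
completed local ring downstairs.** For an open immersion `ι : P → B`, an ideal sheaf `K` on `B`,
a point `b` of `P` in the support of `K|_P = K.comap ι` with `𝒪_{B,ι b}` Noetherian, an affine
open `V ∋ ι b` and a ring isomorphism `eB : 𝒪̂_{B,ι b} ≃ S`: `K|_P` is singular at `b`
(`IsSingularPt`) iff `S ⧸ eB(K · 𝒪̂_{B,ι b})` is not a regular local ring. [folklore] -/
theorem isSingularPt_comap_iff_of_isOpenImmersion {P B : Scheme.{0}} (ι : P ⟶ B)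
    [IsOpenImmersion ι]
    (K : B.IdealSheafData) (b : P) (hb : b ∈ (K.comap ι).support)
    [IsNoetherianRing (B.presheaf.stalk (ι b))] (S : Type) [CommRing S]
    (eB : AdicCompletion (maximalIdeal (B.presheaf.stalk (ι b))) (B.presheaf.stalk (ι b)) ≃+* S)
    (V : B.affineOpens) (hbV : ι b ∈ (V : B.Opens)) :
    IsSingularPt (K.comap ι) b ↔
      ¬ IsRegularLocalRing (S ⧸ (completedStalkIdeal K (ι b) V hbV).map eB.toRingHom) := by
  -- the unique point of the subscheme over `b`
  have h1 : IsSingularPt (K.comap ι) b ↔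
      ¬ IsRegularLocalRing ((K.comap ι).subscheme.presheaf.stalk ⟨b, hb⟩) := by
    constructor
    · rintro ⟨x, hx, hreg⟩
      obtain rfl : x = ⟨b, hb⟩ := Subtype.ext hx
      exact hreg
    · intro h
      exact ⟨⟨b, hb⟩, rfl, h⟩
  -- the local ring of the subscheme is the quotient stalk
  have h2 : IsRegularLocalRing ((K.comap ι).subscheme.presheaf.stalk ⟨b, hb⟩) ↔
      IsRegularLocalRing (P.presheaf.stalk b ⧸ stalkIdeal (K.comap ι) b) :=
    isRegularLocalRing_stalk_subscheme_iff (K.comap ι) ⟨b, hb⟩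
  -- along the open immersion
  let φ : B.presheaf.stalk (ι b) ≃+* P.presheaf.stalk b :=
    (asIso (ι.stalkMap b)).commRingCatIsoToRingEquiv
  have hst : stalkIdeal (K.comap ι) b = (stalkIdeal K (ι b)).map (φ : _ →+* _) := by
    rw [stalkIdeal_comap_eq_map_stalkMap]
    rfl
  have h3 : IsRegularLocalRing (P.presheaf.stalk b ⧸ stalkIdeal (K.comap ι) b) ↔
      IsRegularLocalRing (B.presheaf.stalk (ι b) ⧸ stalkIdeal K (ι b)) := by
    let e := Ideal.quotientEquiv (stalkIdeal K (ι b)) (stalkIdeal (K.comap ι) b) φ hst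
    exact ⟨fun _ => IsRegularLocalRing.of_ringEquiv e.symm,
      fun _ => IsRegularLocalRing.of_ringEquiv e⟩
  -- completion
  have h4 := isRegularLocalRing_quotient_iff_adicCompletion (stalkIdeal K (ι b))
  -- transport along `eB`
  have h5 : IsRegularLocalRing (AdicCompletion (maximalIdeal (B.presheaf.stalk (ι b)))
      (B.presheaf.stalk (ι b)) ⧸ (stalkIdeal K (ι b)).map (algebraMap (B.presheaf.stalk (ι b))
        (AdicCompletion (maximalIdeal (B.presheaf.stalk (ι b))) (B.presheaf.stalk (ι b))))) ↔
      IsRegularLocalRing (S ⧸ ((stalkIdeal K (ι b)).map (algebraMap (B.presheaf.stalk (ι b))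
        (AdicCompletion (maximalIdeal (B.presheaf.stalk (ι b))) (B.presheaf.stalk (ι b))))).map
          eB.toRingHom) := by
    let e := Ideal.quotientEquiv _ _ eB (rfl : ((stalkIdeal K (ι b)).map (algebraMap
      (B.presheaf.stalk (ι b)) (AdicCompletion (maximalIdeal (B.presheaf.stalk (ι b)))
        (B.presheaf.stalk (ι b))))).map eB.toRingHom = _)
    exact ⟨fun _ => IsRegularLocalRing.of_ringEquiv e,
      fun _ => IsRegularLocalRing.of_ringEquiv e.symm⟩
  rw [completedStalkIdeal, ← stalkIdeal_eq_map_germ K V hbV, h1, h2, h3, h4, h5]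

end FormalSingularPt

/-- `stub_formalSingularPt` [L]: **singularity of the strict transform is read in formal
coordinates.** For a point `b` of `B₊(U)` in the support of the strict transform `X'` and any
ring isomorphism `eB` of the completed local ring of `B(U)` at `b̄ = ι b` with a Noetherian ring
`S`, `X'` is singular at `b` (datum sense: `IsSingularPt`) iff
`S ⧸ eB(completed stalk ideal of σˢ(X(U)) at b̄)` is not a regular local ring: the stalk of
`X'.subscheme` at its point over `b` is `𝒪_{B₊,b} ⧸ (stalk ideal) ≅ 𝒪_{B,b̄} ⧸ (stalk ideal)`,
and a Noetherian local ring is regular iff its completion is (Matsumura Thm. 8.11 / §19), the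
completion of the quotient being the quotient of the completion; `𝒪_{B,b̄}` is Noetherian because
`B(U)` is regular (Włodarczyk 2.3.9, landed `stub_cobordantBlowup_regular`). [folklore] -/
theorem stub_formalSingularPt :
    ∀ (k : Type) [Field k] ⦃Y : Scheme.{0}⦄ (f : Y ⟶ Spec (.of k)) [Smooth f] [IsSeparated f] [QuasiCompact f]
      (R : ReesAlgebraData Y), R.IsRegularWeightedCentre → ∀ (U : Y.affineOpens) (X : Y.IdealSheafData)
      (b : R.cobordantPlus U), (b : ↥(R.cobordantPlus U)) ∈ (R.cobordantStrictTransform U X).support →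
      ∀ (S : Type) [CommRing S] [IsNoetherianRing S]
      (eB : AdicCompletion (IsLocalRing.maximalIdeal ((affineCobordantBlowup (R.chartIdeals U)).presheaf.stalk
            ((affineCobordantBlowup.plusOpens (R.chartIdeals U)).ι b)))
          ((affineCobordantBlowup (R.chartIdeals U)).presheaf.stalk
            ((affineCobordantBlowup.plusOpens (R.chartIdeals U)).ι b)) ≃+* S)
      (V : (affineCobordantBlowup (R.chartIdeals U)).affineOpens)
      (hbV : (affineCobordantBlowup.plusOpens (R.chartIdeals U)).ι b ∈ (V : (affineCobordantBlowup (R.chartIdeals U)).Opens)),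
      (IsSingularPt (R.cobordantStrictTransform U X) b ↔
        ¬ IsRegularLocalRing (S ⧸ (completedStalkIdeal (affineCobordantBlowup.idealSheaf (R.chartIdeals U)
          (extReesAlgebra.strictTransform (R.chartIdeals U) (X.ideal U)))
          ((affineCobordantBlowup.plusOpens (R.chartIdeals U)).ι b) V hbV).map eB.toRingHom)) := by
  intro k _ Y f _ _ _ R hR U X b hb S _ _ eB V hbV
  -- `B(U)` is regular, so its local ring at `ι b` is Noetherian
  have hreg : Scheme.IsRegular (affineCobordantBlowup (R.chartIdeals U)) :=
    (stub_cobordantBlowup_regular stub_extRees_bridge f R hR U).1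
  haveI : IsRegularLocalRing ((affineCobordantBlowup (R.chartIdeals U)).presheaf.stalk
      ((affineCobordantBlowup.plusOpens (R.chartIdeals U)).ι b)) := hreg _
  exact FormalSingularPt.isSingularPt_comap_iff_of_isOpenImmersion
    (affineCobordantBlowup.plusOpens (R.chartIdeals U)).ι
    (affineCobordantBlowup.idealSheaf (R.chartIdeals U)
      (extReesAlgebra.strictTransform (R.chartIdeals U) (X.ideal U))) b hb S eB V hbV

end Summit.ResolutionOfSingularities.ResolutionOfSingularities.Theorems

end
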